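import Summits.QuantumFields.YangMills.Theorems.AlphaInputsT3ACv3StartCertSmall
import Summits.QuantumFields.YangMills.Theorems.AlphaInputsT3ACv3AdaptedClassX
import Summits.QuantumFields.YangMills.Theorems.AlphaInputsT3ACHistories
import Literature.MathematicalPhysics.QuantumFieldTheory.Balaban1983to89.B10Eq42TorusConstraint
import HarnessLib

/-!
# `AlphaInputsT3ACv3HLiftSmall` — the (FL) `hLift` binder, **SMALL-k HALF, IN THE BINDER'S OWN LETTERS**: for `L^k < 16`, at the region `Ω := Ω_{k+1}(h)` of ANY history and ANY window
# `ε′ > 0`, the section `U := iterSec k V` is an EXACT `k`-fold lift of `V` (on every coarse bond, a fortiori on `bondsIn k Ω`) whose constrained plaquettes are `< B·ε′·(L^k)⁻²` for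
# every `B > 256` — no tubes, no balls, no Newton step; generic `Params`, any `SU(n)` (at `n = Fin 2` the average `ℰp` is `expMeanLogSU` by `rfl`) — lane `pub-balaban3d` ∕ cell
# `ym3-torus`, seat `ym-ust-19936-w1` (g2, LEAD)

WHY (OWNER (J) 03:44Z: ★w4 g2 types the M22 skeleton `hLift_clause_of_start` for `16 ≤ L^k` from the START rows + (K1)–(K7); the complementary case is THIS file, closed outright).
WHAT IS HERE: ★★`hLift_small` (the `∃ U` clause of p590363's `hrows` for one `(k, h, V)` with `L^k < 16`, `B > 256`, `ε′ > 0`).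
HONEST FRAMING.  The `16 ≤ L^k` half (Newton) is NOT here; (FL)∕`hLift` as a whole NOT proved; count-neutral helper toward R3 2′ (items 19936∕19935); registry untouched; nothing about
d = 4, the continuum, or a mass gap; YM₃ on T³ is rung R3, not Clay.

References: T. Bałaban, Commun. Math. Phys. 102 (1985) 277–309 [Balaban1985Variational] (Thm 1 (8) p.279, (11) p.279); Commun. Math. Phys. 102 (1985) 255–275 [Balaban1985UV3]
((38)–(42) p.266).
-/

set_option autoImplicit false

noncomputable section

open scoped Matrix.Norms.L2Operator

namespace Summit.QuantumFields.YangMills.Theorems.TubeStart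

open Literature.MathematicalPhysics.QuantumFieldTheory.Balaban1983to89
open T4Continuum BlockAveraging ExpMeanLog
open Literature.MathematicalPhysics.QuantumFieldTheory.Balaban1983to89.BlockAveragingSectionAction (iterSec)
open Literature.MathematicalPhysics.QuantumFieldTheory.Balaban1983to89.B10Eq38TorusDomains (plaqsIn)
open Literature.MathematicalPhysics.QuantumFieldTheory.Balaban1983to89.B10Eq42TorusConstraint (bondsIn)
open Summit.QuantumFields.Balaban3D.Carriers

variable {P : Params} {n : Type*} [Fintype n] [DecidableEq n] [Nonempty n] (M₁ : ℕ) (Rcol : ℕ → ℕ) {k : ℕ}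

open Classical in
/-- **★★ THE `hLift` CLAUSE FOR `L^k < 16`**: an exact `k`-fold lift with constrained plaquettes `< B·ε′·(L^k)⁻²` (`B > 256`, `ε′ > 0`), at `Ω_{k+1}(h)`.
[cite: Balaban1985Variational, Thm 1 (8) p.279, (11) p.279] -/
theorem hLift_small (hk : k ≤ P.m + P.K) (hLk : P.L ^ k < 16) (h : Hist P (k + 1)) {ε' B : ℝ} (hε : 0 < ε') (hB : 256 < B)
    (V : GaugeField P k (Matrix.specialUnitaryGroup n ℂ))
    (hV : ∀ Q : Plaq P k, Q ∈ plaqsIn k (Omega M₁ Rcol (k + 1) h (k + 1)) → GaugeGroup.dist1 (GaugeField.plaqHol V Q) ≤ ε') :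
    ∃ U : GaugeField P 0 (Matrix.specialUnitaryGroup n ℂ),
      (∀ b : PBond P k, b ∈ bondsIn k (Omega M₁ Rcol (k + 1) h (k + 1)) →
        Averaging.iter (fun i => (blockAvg (expMeanLogSU (n := n)) : Averaging P i (Matrix.specialUnitaryGroup n ℂ))) k U b = V b) ∧
      ∀ q : Plaq P 0, q ∈ plaqsIn 0 (Omega M₁ Rcol (k + 1) h (k + 1)) →
        GaugeGroup.dist1 (GaugeField.plaqHol U q) < B * ε' * (((P.L : ℝ) ^ k)⁻¹) ^ 2 := by
  -- saturation of `Ω_{k+1}(h)` level by level (★alpha-2's `mem_Omega_iff_of_coarsen_eq`; = `omega_satR` of `…StartOmegaSat`)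
  have hsatR : ∀ s, s < k → ∀ z : Site P s, B10Eq38TorusDomains.toFine s z ∈ Omega M₁ Rcol (k + 1) h (k + 1) ↔
      B10Eq38TorusDomains.toFine (s + 1) (blockOf z) ∈ Omega M₁ Rcol (k + 1) h (k + 1) := by
    intro s hs z
    refine mem_Omega_iff_of_coarsen_eq M₁ Rcol h (j' := s + 1) (by omega) le_rfl ?_
    rw [coarsen_succ, coarsen_toFine s (by omega), coarsen_toFine (s + 1) (by omega)]
  obtain ⟨hP, hsec, -⟩ := startSmall_cert k (Omega M₁ Rcol (k + 1) h (k + 1)) V hk hLk hε.le hsatR hV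
  refine ⟨iterSec k V, fun b _ => by rw [hsec], fun q hq => ?_⟩
  have hLpos : (0 : ℝ) < (P.L : ℝ) ^ k := by
    have : (1 : ℝ) ≤ (P.L : ℝ) ^ k := by exact_mod_cast Nat.one_le_pow _ _ P.L_pos
    linarith
  have hcast : ((P.L ^ k : ℕ) : ℝ) = (P.L : ℝ) ^ k := by push_cast; ring
  calc GaugeGroup.dist1 (GaugeField.plaqHol (iterSec k V) q) ≤ 256 * ε' / ((P.L ^ k : ℕ) : ℝ) ^ 2 := hP q hq
    _ = 256 * ε' * (((P.L : ℝ) ^ k)⁻¹) ^ 2 := by rw [hcast]; field_simp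
    _ < B * ε' * (((P.L : ℝ) ^ k)⁻¹) ^ 2 := by
        have : (0 : ℝ) < ε' * (((P.L : ℝ) ^ k)⁻¹) ^ 2 := by positivity
        nlinarith

end Summit.QuantumFields.YangMills.Theorems.TubeStart

end
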